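import Summits.MatrixMultiplication.MatrixMultiplication.Statement
import Summits.MatrixMultiplication.MatrixMultiplication.Theorems.FarEdgeDescentStratumPinningCore
import Summits.MatrixMultiplication.MatrixMultiplication.Theorems.FarEdgeDescentWeightFamily
import Summits.MatrixMultiplication.MatrixMultiplication.Theorems.FarEdgeDescentTwistQuantumTwin
import Literature.Computability.AlgebraicComplexity.AsymptoticSubrankDuality
import Literature.Computability.AlgebraicComplexity.AsymptoticSpectrumDuality
import Literature.Computability.AlgebraicComplexity.AsymptoticRankMatMul
import Literature.Computability.AlgebraicComplexity.TensorRestrictionRank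
import HarnessLib

/-!
# The same-support stratum of `⟨2,2,2⟩` is pinned from below: `Q̃ = 4` on every weighted star and every transposed weighted star

Route `FarEdgeDescent` (cell `decomp-mm`, lens 2 «structural dichotomy (special vs generic)»,
gen 33), Kernel VIII-b; support for the aside `SubLogRate` (stmt-MatrixMultiplication-25371).

Kernel VII (gen 32) classified the twists of `⟨2,2,2⟩` in the route's two-leaf coordinates — the
special member `𝔖^1 ≅ ⟨2,2,2⟩`, the transposed star `𝔖^ᵀ = twistedStar` (lens-4's coupled CW block
`C₁` up to relabelling), the sign star `𝔖^♭ = signStar`, its transpose `𝔖^{♭ᵀ} = signTStar`, the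
family `𝔖(q) = fam q` — and showed that all quantum functionals agree on them
(`FarEdgeDescentTwistQuantumTwin`) while no degeneration relates the generic ones to `⟨2,2,2⟩`.
This file adds the LOWER pin and draws the consequence for spectral separation:

1. (`FarEdgeDescentStratumPinningCore`) the engine `four_le_asymptoticSubrank_of_tables` — an
   8-point tight support with 2-point rows on `4 × 4 × 4` index sets gives `Q̃ ≥ 4` (lens-4's
   Strassen bound `le_asymptoticSubrank_of_tight` at the uniform distribution) — and the supports /
   tight labellings of the two twist shapes.
2. `four_le_asymptoticSubrank_weightedStar`, `four_le_asymptoticSubrank_weightedTStar` — for EVERY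
   nowhere-zero weight table `w`: `4 ≤ Q̃(𝔖^w)` and `4 ≤ Q̃(𝔖^{wᵀ})` (explicit tight labellings
   `starα/β/γ`, `tstarα/β/γ` of the two supports, checked by `decide`); with `Q̃ ≤ |ι| = 4`:
   `asymptoticSubrank_weightedStar`, `asymptoticSubrank_weightedTStar` — **`Q̃ = 4` exactly**; instances
   `⟨2,2,2⟩`-star, `𝔖^ᵀ`, `𝔖^♭`, `𝔖^{♭ᵀ}`, `𝔖(q)` (`asymptoticSubrank_signStar`, …).
3. Hence (Strassen duality, tree facts `strassen_duality_asymptoticSubrank_holds`,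
   `strassen_duality_asymptoticRank_holds`): every universal spectral point `F` satisfies
   **`4 ≤ F(𝔖^w)`, `4 ≤ F(𝔖^{wᵀ})`** (`four_le_spectralPoint_weightedStar/TStar`), and
   `4 ≤ R̃(𝔖^w)`, `4 ≤ R̃(𝔖^{wᵀ})`.
4. THE CONSUMER (what the pin is for). `separation_forces_excess`: two tensors pinned at `4` from below
   can be separated by a universal spectral point only by a value `> 4`, i.e. only if one of them has
   `R̃ > 4`; `stratum_separation_forces_arc_failure`: **a spectral point separating two members of the
   stratum (any two of `𝔖^w`, `𝔖^{w'}`, `𝔖^{wᵀ}`, `𝔖^{w'ᵀ}`) exhibits an explicit tight `4 × 4 × 4`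
   tensor with `R̃ > 4`, a counterexample to Strassen's asymptotic rank conjecture**; and under
   `ω = 2` (`⟨2,2,2⟩` then has `F ≡ 4`) a pinned member `X` is asymptotically equivalent to `⟨2,2,2⟩`
   iff `R̃(X) = 4` (`twin_iff_flat_of_summit`).  So the question «is `𝔖^ᵀ` (or `𝔖^♭`, `𝔖^{♭ᵀ}`,
   `𝔖(q)`) asymptotically equivalent to `⟨2,2,2⟩`?» is undecidable by any instrument that does not
   decide the asymptotic rank conjecture at that tensor: every catalogued lower functional (quantum
   functionals, `Q̃`) reads `4` on the whole stratum, and any separating point is an ARC violation or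
   an `ω > 2` certificate (`separation_from_matMul`).

References: V. Strassen, *Degeneration and complexity of bilinear maps*, J. reine angew. Math. 413
(1991) [Strassen1991]; M. Christandl, P. Vrana, J. Zuiddam, *Universal points in the asymptotic
spectrum of tensors*, J. AMS 36 (2023), Prop. 1.6, Thm. 4.4 of arXiv:1709.07851
[ChristandlVranaZuiddam2023]; F. Le Gall, *Powers of tensors and fast matrix multiplication*,
ISSAC 2014, Prop. 4.1 [LeGall2014]; M. Bläser, M. Christandl, J. Zuiddam, *The border support rank of
two-by-two matrix multiplication is seven*, 2018, §2 [BlaserChristandlZuiddam2017]; A. Conner,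
F. Gesmundo, J. M. Landsberg, E. Ventura, Y. Wang, Collect. Math. 72 (2021), Conj. 1.4
[ConnerGesmundoLandsbergVenturaWang2020].
-/

noncomputable section

open scoped BigOperators

set_option linter.dupNamespace false

namespace Summit.MatrixMultiplication.MatrixMultiplication.Theorems.FarEdgeDescentStratumPinning

open Literature.Computability.AlgebraicComplexity
open Summit.MatrixMultiplication.MatrixMultiplication.Theorems.OutsiderSandwichTightSubrank
open Summit.MatrixMultiplication.MatrixMultiplication.Theorems.FarEdgeDescentTwistedStar (twistedStar)
open Summit.MatrixMultiplication.MatrixMultiplication.Theorems.FarEdgeDescentSignTwist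
open Summit.MatrixMultiplication.MatrixMultiplication.Theorems.FarEdgeDescentSignStarSRank
open Summit.MatrixMultiplication.MatrixMultiplication.Theorems.FarEdgeDescentWeightFamily

universe u
/-! ## 3. `Q̃ = 4` on the whole stratum -/

section Pinning

/-- **`4 ≤ Q̃(𝔖^w)`** for every nowhere-zero weight table `w`. [cite: Strassen1991, Thm. (laser method for tight sets)] -/
theorem four_le_asymptoticSubrank_weightedStar {w : Mid → ℂ} (hw : ∀ b, w b ≠ 0) :
    (4 : ℝ) ≤ asymptoticSubrank ℂ (weightedStar ℂ 2 1 w) :=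
  four_le_asymptoticSubrank_of_tables card_leaf card_mid card_leaf _ starSupp
    (weightedStar_ne_zero_iff hw) starα starβ starγ starα_injective starβ_injective starγ_injective
    abs_starα_le abs_starβ_le star_tight card_starSupp star_row₁ star_row₂ star_row₃

/-- **`4 ≤ Q̃(𝔖^{wᵀ})`** for every nowhere-zero weight table `w`. [cite: Strassen1991, Thm. (laser method for tight sets)] -/
theorem four_le_asymptoticSubrank_weightedTStar {w : Mid → ℂ} (hw : ∀ b, w b ≠ 0) :
    (4 : ℝ) ≤ asymptoticSubrank ℂ (weightedTStar ℂ 2 1 w) :=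
  four_le_asymptoticSubrank_of_tables card_leaf card_mid card_leaf _ tstarSupp
    (weightedTStar_ne_zero_iff hw) tstarα tstarβ tstarγ tstarα_injective tstarβ_injective
    tstarγ_injective abs_tstarα_le abs_tstarβ_le tstar_tight card_tstarSupp tstar_row₁ tstar_row₂
    tstar_row₃

/-- **`Q̃(𝔖^w) = 4`** exactly (`Q̃ ≤ |Leaf| = 4`). [cite: ChristandlVranaZuiddam2023, §1.1] -/
theorem asymptoticSubrank_weightedStar {w : Mid → ℂ} (hw : ∀ b, w b ≠ 0) :
    asymptoticSubrank ℂ (weightedStar ℂ 2 1 w) = 4 :=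
  le_antisymm (by simpa [card_leaf] using asymptoticSubrank_le_card (weightedStar ℂ 2 1 w))
    (four_le_asymptoticSubrank_weightedStar hw)

/-- **`Q̃(𝔖^{wᵀ}) = 4`** exactly. [cite: ChristandlVranaZuiddam2023, §1.1] -/
theorem asymptoticSubrank_weightedTStar {w : Mid → ℂ} (hw : ∀ b, w b ≠ 0) :
    asymptoticSubrank ℂ (weightedTStar ℂ 2 1 w) = 4 :=
  le_antisymm (by simpa [card_leaf] using asymptoticSubrank_le_card (weightedTStar ℂ 2 1 w))
    (four_le_asymptoticSubrank_weightedTStar hw)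

/-- `sgn` is nowhere zero. [folklore] -/
theorem sgnWeight_ne_zero' : ∀ b : Mid, sgnWeight ℂ b ≠ 0 := sgnWeight_ne_zero (K := ℂ)

/-- `famW q` is nowhere zero for `q ≠ 0`. [folklore] -/
theorem famW_ne_zero {q : ℂ} (hq : q ≠ 0) : ∀ b : Mid, famW ℂ q b ≠ 0 := fun b => by
  unfold famW; split_ifs <;> simp [hq]

/-- **`Q̃(𝔖^♭) = 4`.** [cite: BlaserChristandlZuiddam2017, Def. 5] -/
theorem asymptoticSubrank_signStar : asymptoticSubrank ℂ (signStar ℂ) = 4 :=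
  asymptoticSubrank_weightedStar sgnWeight_ne_zero'

/-- **`Q̃(𝔖^{♭ᵀ}) = 4`.** [cite: CohnUmans2013, §3] -/
theorem asymptoticSubrank_signTStar : asymptoticSubrank ℂ (signTStar ℂ) = 4 :=
  asymptoticSubrank_weightedTStar sgnWeight_ne_zero'

/-- **`Q̃(𝔖(q)) = 4`** for `q ≠ 0`. [cite: BlaserChristandlZuiddam2017, §2] -/
theorem asymptoticSubrank_fam {q : ℂ} (hq : q ≠ 0) : asymptoticSubrank ℂ (fam ℂ q) = 4 :=
  asymptoticSubrank_weightedStar (famW_ne_zero hq)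

/-- **`Q̃(𝔖^ᵀ) = 4`** for the route's twisted star `𝔖_2(1) = weightedTStar 1` (the `ᵀ` class; the same
number as lens-4's `Q̃(C₁) = 4` for its relabelled copy `C₁`, `OutsiderSandwichBlockRank`). [cite: CoppersmithWinograd1990, §7] -/
theorem asymptoticSubrank_twistedStar : asymptoticSubrank ℂ (twistedStar ℂ 2 1) = 4 := by
  rw [← weightedTStar_one]
  exact asymptoticSubrank_weightedTStar (fun _ => one_ne_zero)

/-- **`Q̃(𝔖^1) = 4`** for the special member (`≅ ⟨2,2,2⟩`). [cite: Strassen1991, Thm. (laser method for tight sets)] -/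
theorem asymptoticSubrank_weightedStar_one :
    asymptoticSubrank ℂ (weightedStar ℂ 2 1 (fun _ => 1)) = 4 :=
  asymptoticSubrank_weightedStar (fun _ => one_ne_zero)

end Pinning

/-! ## 4. Spectral floors and the consumer: separation forces excess -/

section Consumer

/-- **Every universal spectral point is `≥ 4` on `𝔖^w`** (`Q̃ = min F`). [cite: ChristandlVranaZuiddam2023, Prop. 1.6] -/
theorem four_le_spectralPoint_weightedStar {w : Mid → ℂ} (hw : ∀ b, w b ≠ 0) {F : SpectralMap ℂ}
    (hF : IsUniversalSpectralPoint ℂ F) : (4 : ℝ) ≤ F (weightedStar ℂ 2 1 w) :=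
  (four_le_asymptoticSubrank_weightedStar hw).trans
    ((strassen_duality_asymptoticSubrank_holds ℂ (weightedStar ℂ 2 1 w)).1 F hF)

/-- **Every universal spectral point is `≥ 4` on `𝔖^{wᵀ}`.** [cite: ChristandlVranaZuiddam2023, Prop. 1.6] -/
theorem four_le_spectralPoint_weightedTStar {w : Mid → ℂ} (hw : ∀ b, w b ≠ 0) {F : SpectralMap ℂ}
    (hF : IsUniversalSpectralPoint ℂ F) : (4 : ℝ) ≤ F (weightedTStar ℂ 2 1 w) :=
  (four_le_asymptoticSubrank_weightedTStar hw).trans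
    ((strassen_duality_asymptoticSubrank_holds ℂ (weightedTStar ℂ 2 1 w)).1 F hF)

/-- From a floor to the asymptotic rank: `(∀ F, 4 ≤ F t) ⟹ 4 ≤ R̃(t)` (`R̃ = max F`). [cite: ChristandlVranaZuiddam2023, Prop. 1.6] -/
theorem four_le_asymptoticRank_of_floor {ι κ μ : Type} [Fintype ι] [Fintype κ] [Fintype μ]
    (t : ι → κ → μ → ℂ) (h : ∀ F, IsUniversalSpectralPoint ℂ F → (4 : ℝ) ≤ F t) :
    (4 : ℝ) ≤ asymptoticRank t := by
  obtain ⟨F, hF, hFt⟩ := (strassen_duality_asymptoticRank_holds ℂ t).2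
  rw [← hFt]
  exact h F hF

/-- **`4 ≤ R̃(𝔖^w)`.** [cite: ChristandlVranaZuiddam2023, Prop. 1.6] -/
theorem four_le_asymptoticRank_weightedStar {w : Mid → ℂ} (hw : ∀ b, w b ≠ 0) :
    (4 : ℝ) ≤ asymptoticRank (weightedStar ℂ 2 1 w) :=
  four_le_asymptoticRank_of_floor _ fun _ hF => four_le_spectralPoint_weightedStar hw hF

/-- **`4 ≤ R̃(𝔖^{wᵀ})`.** [cite: ChristandlVranaZuiddam2023, Prop. 1.6] -/
theorem four_le_asymptoticRank_weightedTStar {w : Mid → ℂ} (hw : ∀ b, w b ≠ 0) :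
    (4 : ℝ) ≤ asymptoticRank (weightedTStar ℂ 2 1 w) :=
  four_le_asymptoticRank_of_floor _ fun _ hF => four_le_spectralPoint_weightedTStar hw hF

/-- **Separation forces excess.** If two tensors are pinned at `4` from below on the asymptotic
spectrum and some universal spectral point separates them, then that point exceeds `4` on one of
them — hence one of them has `R̃ > 4`. [cite: ChristandlVranaZuiddam2023, Prop. 1.6] -/
theorem separation_forces_excess {ι κ μ ι' κ' μ' : Type} [Fintype ι] [Fintype κ] [Fintype μ]
    [Fintype ι'] [Fintype κ'] [Fintype μ'] (X : ι → κ → μ → ℂ) (Y : ι' → κ' → μ' → ℂ)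
    (hX : ∀ F, IsUniversalSpectralPoint ℂ F → (4 : ℝ) ≤ F X)
    (hY : ∀ F, IsUniversalSpectralPoint ℂ F → (4 : ℝ) ≤ F Y)
    {F : SpectralMap ℂ} (hF : IsUniversalSpectralPoint ℂ F) (hsep : F X ≠ F Y) :
    (4 < F X ∧ 4 < asymptoticRank X) ∨ (4 < F Y ∧ 4 < asymptoticRank Y) := by
  have hx := hX F hF
  have hy := hY F hF
  rcases lt_or_gt_of_ne hsep with h | h
  · refine Or.inr ⟨lt_of_le_of_lt hx h, ?_⟩
    exact lt_of_lt_of_le (lt_of_le_of_lt hx h) ((strassen_duality_asymptoticRank_holds ℂ Y).1 F hF)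
  · refine Or.inl ⟨lt_of_le_of_lt hy h, ?_⟩
    exact lt_of_lt_of_le (lt_of_le_of_lt hy h) ((strassen_duality_asymptoticRank_holds ℂ X).1 F hF)

/-- **Separating two members of the stratum forces an ARC failure at one of them**: for nowhere-zero
`w, w'` and either twist shape, a universal spectral point with different values on the two members
exhibits an explicit tight `4 × 4 × 4` tensor with `R̃ > 4`. [cite: ConnerGesmundoLandsbergVenturaWang2020, Conj. 1.4] -/
theorem stratum_separation_forces_arc_failure {w w' : Mid → ℂ} (hw : ∀ b, w b ≠ 0)
    (hw' : ∀ b, w' b ≠ 0) {F : SpectralMap ℂ} (hF : IsUniversalSpectralPoint ℂ F) :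
    (F (weightedStar ℂ 2 1 w) ≠ F (weightedStar ℂ 2 1 w') →
        4 < asymptoticRank (weightedStar ℂ 2 1 w) ∨ 4 < asymptoticRank (weightedStar ℂ 2 1 w')) ∧
      (F (weightedStar ℂ 2 1 w) ≠ F (weightedTStar ℂ 2 1 w') →
        4 < asymptoticRank (weightedStar ℂ 2 1 w) ∨ 4 < asymptoticRank (weightedTStar ℂ 2 1 w')) ∧
      (F (weightedTStar ℂ 2 1 w) ≠ F (weightedTStar ℂ 2 1 w') →
        4 < asymptoticRank (weightedTStar ℂ 2 1 w) ∨
          4 < asymptoticRank (weightedTStar ℂ 2 1 w')) := by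
  refine ⟨fun h => ?_, fun h => ?_, fun h => ?_⟩
  · rcases separation_forces_excess _ _ (fun _ hG => four_le_spectralPoint_weightedStar hw hG)
      (fun _ hG => four_le_spectralPoint_weightedStar hw' hG) hF h with h1 | h2
    exacts [Or.inl h1.2, Or.inr h2.2]
  · rcases separation_forces_excess _ _ (fun _ hG => four_le_spectralPoint_weightedStar hw hG)
      (fun _ hG => four_le_spectralPoint_weightedTStar hw' hG) hF h with h1 | h2
    exacts [Or.inl h1.2, Or.inr h2.2]
  · rcases separation_forces_excess _ _ (fun _ hG => four_le_spectralPoint_weightedTStar hw hG)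
      (fun _ hG => four_le_spectralPoint_weightedTStar hw' hG) hF h with h1 | h2
    exacts [Or.inl h1.2, Or.inr h2.2]

/-- **`4 ≤ F⟨2,2,2⟩` at every universal spectral point**: `⟨2,2,2⟩` restricts to the special member
`𝔖^1` (which is `⟨2,2,2⟩` relabelled along `leafMM`), and `F` is monotone. [cite: Strassen1991, Thm. (laser method for tight sets)] -/
theorem four_le_spectralPoint_matMul {F : SpectralMap ℂ} (hF : IsUniversalSpectralPoint ℂ F) :
    (4 : ℝ) ≤ F (matMulTensor ℂ 2 2 2) := by
  have h := four_le_spectralPoint_weightedStar (w := fun _ => (1 : ℂ)) (fun _ => one_ne_zero) hF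
  refine h.trans (hF.mono _ _ ?_)
  have e : weightedStar ℂ 2 1 (fun _ => 1) =
      fun a b c => matMulTensor ℂ 2 2 2 (leafMM a) b (leafMM c) := by
    funext a b c
    obtain ⟨b₁, b₂⟩ := b
    rcases a with ⟨i, l⟩ | ⟨i, l⟩ <;> rcases c with ⟨k, l'⟩ | ⟨k, l'⟩ <;>
      fin_cases i <;> fin_cases k <;> fin_cases b₁ <;> fin_cases b₂ <;> fin_cases l <;>
      fin_cases l' <;> simp [weightedStar, matMulTensor]
  rw [e]
  exact tensorRestrictsTo_precomp (matMulTensor ℂ 2 2 2) (⇑leafMM) id (⇑leafMM)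

/-- `4 ≤ R̃⟨2,2,2⟩ = 2^ω` read through the spectrum (consistent with `ω ≥ 2`). [cite: ChristandlVranaZuiddam2023, Prop. 1.6] -/
theorem four_le_asymptoticRank_matMul : (4 : ℝ) ≤ asymptoticRank (matMulTensor ℂ 2 2 2) :=
  four_le_asymptoticRank_of_floor _ fun _ hF => four_le_spectralPoint_matMul hF

/-- **Under `ω = 2` every universal spectral point reads exactly `4` on `⟨2,2,2⟩`**
(`4 ≤ F ≤ R̃ = 2^ω = 4`). [cite: AlmanDuanVassilevskaWilliamsXuXuZhou2025, §3.4] -/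
theorem spectralPoint_matMul_eq_four_of_summit (hS : _root_.MatrixMultiplication)
    {F : SpectralMap ℂ} (hF : IsUniversalSpectralPoint ℂ F) : F (matMulTensor ℂ 2 2 2) = 4 := by
  have hω : omega ℂ = 2 := (_root_.MatrixMultiplication_iff).1 hS
  refine le_antisymm ?_ (four_le_spectralPoint_matMul hF)
  calc F (matMulTensor ℂ 2 2 2) ≤ asymptoticRank (matMulTensor ℂ 2 2 2) :=
        (strassen_duality_asymptoticRank_holds ℂ _).1 F hF
    _ = 4 := by rw [asymptoticRank_matMulTensor ℂ 2 (by norm_num), hω]; norm_num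

/-- **Separation from `⟨2,2,2⟩` is an ARC violation or an `ω > 2` certificate.** For a tensor `X`
pinned at `4` from below: a universal spectral point with `F X ≠ F⟨2,2,2⟩` gives `R̃(X) > 4` or
`ω > 2`. [cite: ConnerGesmundoLandsbergVenturaWang2020, Conj. 1.4] -/
theorem separation_from_matMul {ι κ μ : Type} [Fintype ι] [Fintype κ] [Fintype μ]
    (X : ι → κ → μ → ℂ) (hX : ∀ F, IsUniversalSpectralPoint ℂ F → (4 : ℝ) ≤ F X)
    {F : SpectralMap ℂ} (hF : IsUniversalSpectralPoint ℂ F)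
    (hsep : F X ≠ F (matMulTensor ℂ 2 2 2)) :
    4 < asymptoticRank X ∨ ¬ _root_.MatrixMultiplication := by
  by_cases hS : _root_.MatrixMultiplication
  · left
    have h4 : F (matMulTensor ℂ 2 2 2) = 4 := spectralPoint_matMul_eq_four_of_summit hS hF
    have hgt : 4 < F X := lt_of_le_of_ne (hX F hF) (fun h => hsep (by rw [h4, ← h]))
    exact lt_of_lt_of_le hgt ((strassen_duality_asymptoticRank_holds ℂ X).1 F hF)
  · exact Or.inr hS

/-- The stratum instances of `separation_from_matMul`: separating `𝔖^w` or `𝔖^{wᵀ}` (`w` nowhere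
zero) from `⟨2,2,2⟩` by a universal spectral point forces `R̃ > 4` at that member or `ω > 2`. [cite: ConnerGesmundoLandsbergVenturaWang2020, Conj. 1.4] -/
theorem stratum_separation_from_matMul {w : Mid → ℂ} (hw : ∀ b, w b ≠ 0) {F : SpectralMap ℂ}
    (hF : IsUniversalSpectralPoint ℂ F) :
    (F (weightedStar ℂ 2 1 w) ≠ F (matMulTensor ℂ 2 2 2) →
        4 < asymptoticRank (weightedStar ℂ 2 1 w) ∨ ¬ _root_.MatrixMultiplication) ∧
      (F (weightedTStar ℂ 2 1 w) ≠ F (matMulTensor ℂ 2 2 2) →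
        4 < asymptoticRank (weightedTStar ℂ 2 1 w) ∨ ¬ _root_.MatrixMultiplication) :=
  ⟨fun h => separation_from_matMul _ (fun _ hG => four_le_spectralPoint_weightedStar hw hG) hF h,
    fun h => separation_from_matMul _ (fun _ hG => four_le_spectralPoint_weightedTStar hw hG) hF h⟩

/-- **Under `ω = 2`: a pinned tensor is a spectral twin of `⟨2,2,2⟩` iff it is flat (`R̃ = 4`).**
(`⟹`: `R̃(X) = max F(X) = max F⟨2,2,2⟩ = 4`; `⟸`: `4 ≤ F ≤ R̃ = 4` on both.) [cite: ChristandlVranaZuiddam2023, Prop. 1.6] -/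
theorem twin_iff_flat_of_summit (hS : _root_.MatrixMultiplication) {ι κ μ : Type} [Fintype ι]
    [Fintype κ] [Fintype μ] (X : ι → κ → μ → ℂ)
    (hX : ∀ F, IsUniversalSpectralPoint ℂ F → (4 : ℝ) ≤ F X) :
    (∀ F, IsUniversalSpectralPoint ℂ F → F X = F (matMulTensor ℂ 2 2 2)) ↔
      asymptoticRank X = 4 := by
  constructor
  · intro htwin
    obtain ⟨G, hG, hGX⟩ := (strassen_duality_asymptoticRank_holds ℂ X).2
    refine le_antisymm ?_ (four_le_asymptoticRank_of_floor X hX)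
    rw [← hGX, htwin G hG, spectralPoint_matMul_eq_four_of_summit hS hG]
  · intro hflat F hF
    have h1 : F X ≤ 4 := hflat ▸ (strassen_duality_asymptoticRank_holds ℂ X).1 F hF
    have h2 : (4 : ℝ) ≤ F X := hX F hF
    rw [spectralPoint_matMul_eq_four_of_summit hS hF]
    exact le_antisymm h1 h2

/-- The stratum instances: under `ω = 2`, `𝔖^w` (resp. `𝔖^{wᵀ}`) is a spectral twin of `⟨2,2,2⟩`
iff `R̃(𝔖^w) = 4` (resp. `R̃(𝔖^{wᵀ}) = 4`), i.e. iff the asymptotic rank conjecture holds at it.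
[cite: ConnerGesmundoLandsbergVenturaWang2020, Conj. 1.4] -/
theorem stratum_twin_iff_flat_of_summit (hS : _root_.MatrixMultiplication) {w : Mid → ℂ}
    (hw : ∀ b, w b ≠ 0) :
    ((∀ F, IsUniversalSpectralPoint ℂ F → F (weightedStar ℂ 2 1 w) = F (matMulTensor ℂ 2 2 2)) ↔
        asymptoticRank (weightedStar ℂ 2 1 w) = 4) ∧
      ((∀ F, IsUniversalSpectralPoint ℂ F →
          F (weightedTStar ℂ 2 1 w) = F (matMulTensor ℂ 2 2 2)) ↔
        asymptoticRank (weightedTStar ℂ 2 1 w) = 4) :=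
  ⟨twin_iff_flat_of_summit hS _ fun _ hG => four_le_spectralPoint_weightedStar hw hG,
    twin_iff_flat_of_summit hS _ fun _ hG => four_le_spectralPoint_weightedTStar hw hG⟩

end Consumer

end Summit.MatrixMultiplication.MatrixMultiplication.Theorems.FarEdgeDescentStratumPinning

end
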